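import Summits.ResolutionOfSingularities.ResolutionOfSingularities.Theorems.MarkedTransferCampaignW46ThreefoldsGammaFreeGlobalLocal
import Summits.ResolutionOfSingularities.ResolutionOfSingularities.Theorems.MarkedTransferCampaignW46ThreefoldsGammaFreeGlobalEtale
import HarnessLib

/-!
# [OURS · L1 W4.6 rung (ii)] PATCHING: order-reducibility may be proved PIECE BY PIECE on open sets around DISJOINT parts of
# the order-`≥ m` locus — a relative extension lemma (points off the piece stay untouched) and the two-piece patching
# theorem, PROVED (any dimension)

Cell res-hironaka, LADDER-RESOLUTION rung L (D-0089), slot W4.6, rung (ii) (threefold hypersurfaces) in the DIMENSION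
LADDER of the Γ-free statement (`CampaignW46.OrderReducible`, p496755). Seat res-L1-s46-pv-3 (gen 3). Host route
MarkedTransfer, host item `HypersurfaceOrderReductionDimLeThree` (stmt-ResolutionOfSingularities-16156); filed
`--kind proof --supports` it `--as helper`. Everything here is OURS scheme theory over the campaign predicate and PROVED tree
lemmas; nothing of H. Hironaka's manuscript is asserted. AI-written; AI review is weaker than expert review.
It extends res-D-pv-049 AS res-L1-s46-pv-11's brick B6 (`…GammaFreeGlobalLocal.lean` p500913: ONE open neighbourhood of
the WHOLE order-`≥ m` locus) to SEVERAL pieces — the glue by which slices of rung (ii) at `d = 3` (monomial here, cylinder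
there, a maximal-contact chart elsewhere) combine, and the form (α) of the design memo for the tame double-point rung.

## What is proved (no new definitions)

* `CampaignW46.controlledTransform_top` — the controlled transform along the unit-ideal «centre» is the pull-back.
* `CampaignW46.IsPermissibleBlowupSeq.exists_extension_of_isOpenImmersion_rel` — **RELATIVE EXTENSION**: `X` regular locally
  Noetherian, `u : V → X` an open immersion, `Z ⊆ u(V)` closed such that every point of `u(V)` of order `≥ m` for `J` lies
  in `Z` (points of order `≥ m` OUTSIDE `u(V)` are allowed). Every sequence of permissible blowing-ups for `(u^*J, m)` on
  `V` is the restriction of one for `(J, m)` on `X` (`u′ ≫ Φ = σ ≫ u`, `u′^*J′ = K′`), all of whose centres lie over `Z`,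
  so that: every point over `Z` is in the image of `u′`; every point of the image of `u′` of order `≥ m` lies over `Z`;
  and OVER THE COMPLEMENT `O = X ∖ Z` NOTHING HAPPENS — `(Φ⁻¹O ↪ X′) ≫ Φ` is an open immersion and `J′|_{Φ⁻¹O}` is the
  pull-back of `J`. (pv-11's `exists_extension_of_isOpenImmersion`, same mechanism — blow up `X_i` along the image of the
  centre, closed because it lies over `Z` — with the weaker hypothesis and the two extra invariants; blow-ups are
  isomorphisms off their centres, tree `IsBlowup.isIso_morphismRestrict`; controlled transforms commute with flat base
  change, `comap_controlledTransform_of_flat`.)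
* `CampaignW46.OrderReducible.of_opens_pair` — **TWO-PIECE PATCHING**: if the order-`≥ m` locus of `J` lies in
  `Z₁ ∪ Z₂` with `Z₁, Z₂` closed, `Zᵢ ⊆ Vᵢ` open, `Z₁ ∩ V₂ = ∅ = Z₂ ∩ V₁`, and `(Vᵢ, J|_{Vᵢ}, m)` is order-reducible for
  `i = 1, 2`, then `(X, J, m)` is order-reducible: extend the reduction of piece 1 relatively; over `X ∖ Z₁ ⊇ V₂` the
  result is (an open immersion onto) the original, so piece 2's reduction transports (`OrderReducible.comap_of_etale`)
  and pv-11's one-piece lemma finishes on the first extension's last stage (all its points of order `≥ m` lie over `Z₂`).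

HONEST VALUE. Structure (glue), not a rung. With it, «settled» becomes a LOCAL property of each far-apart part of
`Sing(J, m)` separately.

References: `…GammaFreeGlobalLocal.lean` (p500913, res-D-pv-049: `IsPermissibleBlowupSeq.exists_extension_of_isOpenImmersion`,
`OrderReducible.of_isOpenImmersion`, `isRegular_subscheme_of_support_subset_range`), `…GammaFreeGlobalEtale.lean` (p500660:
`OrderReducible.comap_of_etale`), `…GammaFreeGlobalLadder.lean` (p496755: `OrderReducible.of_isPermissibleBlowupSeq`); tree
`Resolution/Blowups.lean` (`IsBlowup.isIso_morphismRestrict`, `IsBlowup.lift` [GortzWedhorn2020, Prop. 13.91]),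
`Resolution/MarkedIdealsEtale.lean` (`comap_controlledTransform_of_flat`, `idealOrder_comap_of_etale`),
`Resolution/RegularCentreBlowupSeqExtension.lean` (`closureImage`, `comap_vanishingIdeal_closureImage` [Piltant2013, Prop. 5.1]).
H. Hironaka, ms. 2017-03-23, Def. 2.4 p.6 — scope only, under adjudication, not cited as fact. [Hironaka2017]
-/

noncomputable section

set_option linter.dupNamespace false -- mandated namespace of this single-conjunct summit

open CategoryTheory CategoryTheory.Limits AlgebraicGeometry TopologicalSpace IsLocalRing

namespace Summit.ResolutionOfSingularities.ResolutionOfSingularities.Theorems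

namespace CampaignW46

open Literature.AlgebraicGeometry.Resolution
open Scheme.IdealSheafData
open Literature.AlgebraicGeometry.Hironaka2017

universe u

/-! ## §0 The controlled transform along the unit ideal -/

/-- Along the unit-ideal «centre» the controlled transform is the pull-back: `(π^*L : ⊤^μ) = π^*L`. [folklore] -/
theorem controlledTransform_top {Y Y' : Scheme.{u}} (π : Y' ⟶ Y) (L : Y.IdealSheafData) (μ : ℕ) :
    controlledTransform π ⊤ L μ = L.comap π := by
  rw [controlledTransform, Scheme.IdealSheafData.comap_top, ← Scheme.IdealSheafData.one_eq_top, one_pow,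
    Scheme.IdealSheafData.one_eq_top, colon_top]

/-! ## §1 The relative extension lemma -/

/-- **RELATIVE EXTENSION of a sequence of permissible blowing-ups from an open subscheme.** `X` regular locally
Noetherian, `u : V → X` an open immersion, `Z ⊆ u(V)` closed in `X` such that every point OF `u(V)` of order `≥ m` for `J`
lies in `Z`. Every sequence of permissible blowing-ups `σ : V′ → V` for `(u^*J, m)` with last transform `K′` is the
restriction of a sequence `Φ : X′ → X` for `(J, m)` with last transform `J′` along an open immersion `u′ : V′ → X′`
(`u′ ≫ Φ = σ ≫ u`, `K′ = u′^*J′`) such that: (a) every point of the image of `u′` of order `≥ m` for `J′` lies over `Z`;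
(b) every point over `Z` lies in the image of `u′`; (c) with `O := X ∖ Z`, the composite `Φ⁻¹(O) ↪ X′ → X` is an OPEN
IMMERSION (all centres lie over `Z`, blow-ups are isomorphisms off their centres) and (d) `J′|_{Φ⁻¹ O}` is the pull-back of
`J` along it. [cite: Piltant2013, Prop. 5.1 (proof, Step 2)] [cite: GortzWedhorn2020, Prop. 13.91] -/
theorem IsPermissibleBlowupSeq.exists_extension_of_isOpenImmersion_rel {V X : Scheme.{u}} [IsLocallyNoetherian X]
    (hX : Scheme.IsRegular X) (u : V ⟶ X) [IsOpenImmersion u] (J : X.IdealSheafData) (m : ℕ)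
    (Z : Set X) (hZ : IsClosed Z) (hJZ : ∀ y : V, (m : ℕ∞) ≤ idealOrder J (u y) → u y ∈ Z)
    (hZu : Z ⊆ Set.range u) :
    ∀ {V' : Scheme.{u}} {σ : V' ⟶ V} {K' : V'.IdealSheafData}, IsPermissibleBlowupSeq (J.comap u) m σ K' →
      ∃ (X' : Scheme.{u}) (Φ : X' ⟶ X) (J' : X'.IdealSheafData) (u' : V' ⟶ X'),
        IsPermissibleBlowupSeq J m Φ J' ∧ IsOpenImmersion u' ∧ u' ≫ Φ = σ ≫ u ∧ K' = J'.comap u' ∧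
        (∀ y' : V', (m : ℕ∞) ≤ idealOrder J' (u' y') → Φ (u' y') ∈ Z) ∧
        (∀ x' : X', Φ x' ∈ Z → x' ∈ Set.range u') ∧
        IsOpenImmersion ((Φ ⁻¹ᵁ ⟨Zᶜ, hZ.isOpen_compl⟩).ι ≫ Φ) ∧
        J'.comap (Φ ⁻¹ᵁ ⟨Zᶜ, hZ.isOpen_compl⟩).ι = J.comap ((Φ ⁻¹ᵁ ⟨Zᶜ, hZ.isOpen_compl⟩).ι ≫ Φ) := by
  intro V' σ K' h
  induction h with
  | nil =>
    refine ⟨X, 𝟙 X, J, u, IsPermissibleBlowupSeq.nil, inferInstance, by simp, rfl,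
      fun y hy => hJZ y (by simpa using hy), fun x hx => hZu (by simpa using hx), ?_, ?_⟩
    · rw [Category.comp_id]; infer_instance
    · rw [Category.comp_id]
  | @blowup V₂ V₁ σ₁ K₁ hseq D π hreg hD hπ ih =>
    obtain ⟨X₁, Φ₁, J₁, u₁, hseq₁, hu₁, hcomm₁, hK₁, ha₁, hb₁, hopen₁, hJO₁⟩ := ih
    haveI := hu₁
    obtain ⟨hN₁, hX₁⟩ := hseq₁.isLocallyNoetherian_and_isRegular inferInstance hX
    haveI := hN₁
    haveI : IsLocallyNoetherian V₁ := LocallyOfFiniteType.isLocallyNoetherian u₁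
    set O : X.Opens := ⟨Zᶜ, hZ.isOpen_compl⟩ with hO
    -- orders on `V₁` are orders on `X₁`
    have hordu : ∀ y : V₁, idealOrder K₁ y = idealOrder J₁ (u₁ y) := fun y => by
      rw [hK₁]; exact idealOrder_comap_of_etale u₁ J₁ y
    -- the image of the centre lies over `Z`, hence is closed in `X₁`
    have himZ : ∀ y ∈ (D : Set V₁), Φ₁ (u₁ y) ∈ Z := fun y hy =>
      ha₁ y (by rw [← hordu]; exact hD y hy)
    have hcl : closure (u₁ '' (D : Set V₁)) = u₁ '' (D : Set V₁) := by
      refine Set.Subset.antisymm (fun x hx => ?_) subset_closure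
      have hxZ : Φ₁ x ∈ Z := by
        have hsub : closure (u₁ '' (D : Set V₁)) ⊆ Φ₁ ⁻¹' Z :=
          closure_minimal (by rintro _ ⟨y, hy, rfl⟩; exact himZ y hy) (hZ.preimage Φ₁.continuous)
        exact hsub hx
      obtain ⟨y, rfl⟩ := hb₁ x hxZ
      have hy : y ∈ ((closureImage u₁ (D : Set V₁)).preimage u₁.continuous : Set V₁) := hx
      rw [preimage_closureImage_eq] at hy
      exact ⟨y, hy, rfl⟩
    -- the centre on `X₁`: the reduced closed subscheme on `u₁(D)`
    set DX : Closeds X₁ := closureImage u₁ (D : Set V₁) with hDX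
    have hDXcoe : (DX : Set X₁) = u₁ '' (D : Set V₁) := by rw [hDX, coe_closureImage, hcl]
    set C : X₁.IdealSheafData := vanishingIdeal DX with hCdef
    have hC : C.comap u₁ = vanishingIdeal D := comap_vanishingIdeal_closureImage u₁ D
    have hregX : Scheme.IsRegular (vanishingIdeal DX).subscheme := by
      refine isRegular_subscheme_of_support_subset_range u₁ C (fun x hx => ?_) (by rw [hC]; exact hreg)
      rw [hCdef, coe_support_vanishingIdeal, hDXcoe] at hx
      obtain ⟨y, -, rfl⟩ := hx
      exact ⟨y, rfl⟩
    have hDXord : ∀ x ∈ (DX : Set X₁), (m : ℕ∞) ≤ idealOrder J₁ x := by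
      intro x hx
      rw [hDXcoe] at hx
      obtain ⟨y, hy, rfl⟩ := hx
      rw [← hordu]
      exact hD y hy
    -- the centre misses `Φ₁⁻¹ O`
    have hdisj : Disjoint ((Φ₁ ⁻¹ᵁ O : X₁.Opens) : Set X₁) (C.support : Set X₁) := by
      rw [Set.disjoint_left]
      intro x hxO hxC
      rw [hCdef, coe_support_vanishingIdeal, hDXcoe] at hxC
      obtain ⟨y, hy, rfl⟩ := hxC
      exact hxO (himZ y hy)
    -- blow up `X₁` along it
    obtain ⟨X₂, πX, hπX⟩ := exists_isBlowup X₁ C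
    have hstep : IsPermissibleBlowupSeq J m (πX ≫ Φ₁) (controlledTransform πX (vanishingIdeal DX) J₁ m) :=
      hseq₁.blowup DX πX hregX hDXord hπX
    have hπ' : IsBlowup π (C.comap u₁) := by rw [hC]; exact hπ
    let u₂ : V₂ ⟶ X₂ := hπX.lift (π ≫ u₁)
      (by rw [Scheme.IdealSheafData.comap_comp]; exact hπ'.isEffectiveCartier)
    have hu₂π : u₂ ≫ πX = π ≫ u₁ := hπX.lift_comp _ _
    have hsq : IsPullback u₂ π πX u₁ := hπX.isPullback_of_isOpenImmersion u₁ hπ' hu₂π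
    haveI : IsOpenImmersion u₂ := MorphismProperty.of_isPullback hsq.flip inferInstance
    obtain ⟨hN₂, -⟩ := hstep.isLocallyNoetherian_and_isRegular inferInstance hX
    haveI := hN₂
    haveI : IsLocallyNoetherian V₂ := LocallyOfFiniteType.isLocallyNoetherian u₂
    -- transforms match along `u₂`
    have hle : J₁.comap πX ≤ C.comap πX ^ m :=
      comap_le_comap_pow_of_le_pow (le_vanishingIdeal_pow_of_forall_le_idealOrder hX₁ hregX hDXord) πX
    have hDs : IsEffectiveCartier ((C.comap πX).comap u₂) := by
      rw [← Scheme.IdealSheafData.comap_comp, hu₂π, Scheme.IdealSheafData.comap_comp, hC]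
      exact hπ.isEffectiveCartier
    have hK₂ : controlledTransform π (vanishingIdeal D) K₁ m =
        (controlledTransform πX (vanishingIdeal DX) J₁ m).comap u₂ := by
      rw [comap_controlledTransform_of_isEffectiveCartier u₁ hu₂π C J₁ m hπX.isEffectiveCartier hle hDs,
        hC, ← hK₁]
    -- over `O` the new blow-up is an isomorphism
    haveI hiso : IsIso (πX ∣_ (Φ₁ ⁻¹ᵁ O)) := hπX.isIso_morphismRestrict hdisj
    have hfac : (πX ⁻¹ᵁ (Φ₁ ⁻¹ᵁ O)).ι ≫ πX ≫ Φ₁ = (πX ∣_ (Φ₁ ⁻¹ᵁ O)) ≫ ((Φ₁ ⁻¹ᵁ O).ι ≫ Φ₁) := by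
      rw [← Category.assoc, ← morphismRestrict_ι, Category.assoc]
    haveI hopen₂ : IsOpenImmersion ((πX ∣_ (Φ₁ ⁻¹ᵁ O)) ≫ ((Φ₁ ⁻¹ᵁ O).ι ≫ Φ₁)) :=
      @IsOpenImmersion.comp _ _ _ (πX ∣_ (Φ₁ ⁻¹ᵁ O)) ((Φ₁ ⁻¹ᵁ O).ι ≫ Φ₁) inferInstance hopen₁
    refine ⟨X₂, πX ≫ Φ₁, controlledTransform πX (vanishingIdeal DX) J₁ m, u₂, hstep, inferInstance,
      by rw [← Category.assoc, hu₂π, Category.assoc, hcomm₁, Category.assoc], hK₂, fun y₂ hy₂ => ?_,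
      fun x₂ hx₂ => ?_, ?_, ?_⟩
    · -- (a) points of the image of order `≥ m` lie over `Z`
      rw [Scheme.Hom.comp_apply]
      by_cases hmem : πX (u₂ y₂) ∈ (C.support : Set X₁)
      · rw [hCdef, coe_support_vanishingIdeal, hDXcoe] at hmem
        obtain ⟨y, hy, hyx⟩ := hmem
        rw [← hyx]
        exact himZ y hy
      · rw [hπX.idealOrder_controlledTransform_of_not_mem J₁ m hmem] at hy₂
        have h1 : πX (u₂ y₂) = u₁ (π y₂) := by
          rw [← Scheme.Hom.comp_apply, hu₂π, Scheme.Hom.comp_apply]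
        rw [h1] at hy₂ ⊢
        exact ha₁ (π y₂) hy₂
    · -- (b) points over `Z` lie in the image of `u₂ = u₁ ×_{X₁} X₂`
      rw [Scheme.Hom.comp_apply] at hx₂
      obtain ⟨y, hy⟩ := hb₁ _ hx₂
      obtain ⟨z, hz, -⟩ := Scheme.Pullback.exists_preimage_pullback x₂ y hy.symm
      refine ⟨(hsq.isoPullback).inv z, ?_⟩
      rw [← hz, ← Scheme.Hom.comp_apply, IsPullback.isoPullback_inv_fst]
    · -- (c) open immersion over `O`
      change IsOpenImmersion ((πX ⁻¹ᵁ (Φ₁ ⁻¹ᵁ O)).ι ≫ πX ≫ Φ₁)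
      rw [hfac]
      exact hopen₂
    · -- (d) the transform over `O` is the pull-back
      have hsqO : (πX ⁻¹ᵁ (Φ₁ ⁻¹ᵁ O)).ι ≫ πX = (πX ∣_ (Φ₁ ⁻¹ᵁ O)) ≫ (Φ₁ ⁻¹ᵁ O).ι :=
        (morphismRestrict_ι _ _).symm
      have hCO : (vanishingIdeal DX).comap (Φ₁ ⁻¹ᵁ O).ι = ⊤ := by
        rw [← Scheme.IdealSheafData.support_eq_bot_iff, Scheme.IdealSheafData.support_comap]
        ext x
        simp only [Closeds.coe_preimage, Set.mem_preimage, Closeds.coe_bot, Set.mem_empty_iff_false, iff_false]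
        intro hx
        exact Set.disjoint_left.mp hdisj x.2 hx
      change (controlledTransform πX (vanishingIdeal DX) J₁ m).comap (πX ⁻¹ᵁ (Φ₁ ⁻¹ᵁ O)).ι =
        J.comap ((πX ⁻¹ᵁ (Φ₁ ⁻¹ᵁ O)).ι ≫ πX ≫ Φ₁)
      rw [comap_controlledTransform_of_flat (Φ₁ ⁻¹ᵁ O).ι hsqO (vanishingIdeal DX) J₁ m, hCO,
        controlledTransform_top, hJO₁, ← Scheme.IdealSheafData.comap_comp, hfac]

/-! ## §2 Two-piece patching -/

/-- **TWO-PIECE PATCHING OF ORDER-REDUCIBILITY.** `X` regular locally Noetherian, `J`, `m`; closed sets `Z₁, Z₂` and open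
immersions `u₁ : V₁ → X`, `u₂ : V₂ → X` with `Zᵢ ⊆ uᵢ(Vᵢ)`, `Z₁ ∩ u₂(V₂) = ∅`, `Z₂ ∩ u₁(V₁) = ∅`, and every point of `X` of
order `≥ m` in `Z₁ ∪ Z₂`. If `(Vᵢ, uᵢ^*J, m)` is order-reducible for `i = 1, 2`, then `(X, J, m)` is order-reducible.
(Round 1: the relative extension of piece 1; over `X ∖ Z₁ ⊇ u₂(V₂)` its last stage is an open immersion onto the original
with the pulled-back ideal, so piece 2's reduction transports along the restriction, an open immersion; round 2: pv-11's
one-piece extension on that stage — every point there of order `≥ m` lies over `Z₂`; compose.)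
[cite: Piltant2013, Prop. 5.1 (proof, Step 2)] -/
theorem OrderReducible.of_isOpenImmersion_pair {V₁ V₂ X : Scheme.{u}} [IsLocallyNoetherian X] (hX : Scheme.IsRegular X)
    (J : X.IdealSheafData) {m : ℕ} (u₁ : V₁ ⟶ X) [IsOpenImmersion u₁] (u₂ : V₂ ⟶ X) [IsOpenImmersion u₂]
    (Z₁ Z₂ : Set X) (hZ₁ : IsClosed Z₁) (hZ₂ : IsClosed Z₂) (hZ₁u : Z₁ ⊆ Set.range u₁) (hZ₂u : Z₂ ⊆ Set.range u₂)
    (h12 : Disjoint Z₁ (Set.range u₂)) (h21 : Disjoint Z₂ (Set.range u₁))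
    (hJZ : ∀ x : X, (m : ℕ∞) ≤ idealOrder J x → x ∈ Z₁ ∪ Z₂)
    (h₁ : OrderReducible (J.comap u₁) m) (h₂ : OrderReducible (J.comap u₂) m) : OrderReducible J m := by
  -- round 1: relative extension of piece 1
  obtain ⟨V₁', σ₁, K₁', hseqV₁, hltV₁⟩ := h₁
  have hJZ₁ : ∀ y : V₁, (m : ℕ∞) ≤ idealOrder J (u₁ y) → u₁ y ∈ Z₁ := by
    intro y hy
    rcases hJZ _ hy with h | h
    · exact h
    · exact absurd ⟨y, rfl⟩ (Set.disjoint_left.mp h21 h)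
  obtain ⟨X₁, Φ₁, J₁, u₁', hseq₁, hu₁', hcomm₁, hK₁, ha₁, hb₁, hopen₁, hJO₁⟩ :=
    IsPermissibleBlowupSeq.exists_extension_of_isOpenImmersion_rel hX u₁ J m Z₁ hZ₁ hJZ₁ hZ₁u hseqV₁
  haveI := hu₁'
  haveI := hopen₁
  obtain ⟨hN₁, hX₁⟩ := hseq₁.isLocallyNoetherian_and_isRegular inferInstance hX
  haveI := hN₁
  set O : X.Opens := ⟨Z₁ᶜ, hZ₁.isOpen_compl⟩ with hO
  -- the open of `X₁` over `u₂(V₂)`, inside `Φ₁⁻¹ O`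
  set W : X.Opens := u₂.opensRange with hW
  have hWO : W ≤ O := by
    intro x hx
    exact fun hxZ => Set.disjoint_left.mp h12 hxZ hx
  have hle : Φ₁ ⁻¹ᵁ W ≤ Φ₁ ⁻¹ᵁ O := fun x hx => hWO hx
  -- `Φ₁` restricted over `W` is an open immersion
  have hfacW : (Φ₁ ⁻¹ᵁ W).ι ≫ Φ₁ = X₁.homOfLE hle ≫ ((Φ₁ ⁻¹ᵁ O).ι ≫ Φ₁) := by
    rw [← Category.assoc, Scheme.homOfLE_ι]
  haveI hopenW : IsOpenImmersion ((Φ₁ ⁻¹ᵁ W).ι ≫ Φ₁) := by rw [hfacW]; infer_instance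
  haveI : IsOpenImmersion (Φ₁ ∣_ W) := by
    have h : IsOpenImmersion ((Φ₁ ∣_ W) ≫ W.ι) := by rw [morphismRestrict_ι]; exact hopenW
    exact IsOpenImmersion.of_comp (Φ₁ ∣_ W) W.ι
  -- `J₁` over `W` is the pull-back of `J`
  have hJW : J₁.comap (Φ₁ ⁻¹ᵁ W).ι = J.comap ((Φ₁ ⁻¹ᵁ W).ι ≫ Φ₁) := by
    rw [hfacW, Scheme.IdealSheafData.comap_comp, ← hJO₁, ← Scheme.IdealSheafData.comap_comp, Scheme.homOfLE_ι]
  -- transport piece 2's reduction to `W`, then to `Φ₁⁻¹ W` along the open immersion `Φ₁ ∣_ W`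
  haveI : IsLocallyNoetherian V₂ := LocallyOfFiniteType.isLocallyNoetherian u₂
  have hrange : Set.range u₂ = Set.range W.ι := by rw [Scheme.Opens.range_ι]; rfl
  have he : (IsOpenImmersion.isoOfRangeEq u₂ W.ι hrange).inv ≫ u₂ = W.ι :=
    IsOpenImmersion.isoOfRangeEq_inv_fac _ _ _
  have h₂W : OrderReducible (J.comap W.ι) m := by
    have h := OrderReducible.comap_of_etale (IsOpenImmersion.isoOfRangeEq u₂ W.ι hrange).inv h₂
    rwa [← Scheme.IdealSheafData.comap_comp, he] at h
  have h₂' : OrderReducible (J₁.comap (Φ₁ ⁻¹ᵁ W).ι) m := by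
    have h := OrderReducible.comap_of_etale (Φ₁ ∣_ W) h₂W
    rwa [← Scheme.IdealSheafData.comap_comp, morphismRestrict_ι, ← hJW] at h
  -- round 2: every point of `X₁` of order `≥ m` lies over `Z₂`
  have hJZ₂ : ∀ x₁ : X₁, (m : ℕ∞) ≤ idealOrder J₁ x₁ → x₁ ∈ Φ₁ ⁻¹' Z₂ := by
    intro x₁ hx₁
    by_cases hr : x₁ ∈ Set.range u₁'
    · obtain ⟨y, rfl⟩ := hr
      have hy := hltV₁ y
      rw [hK₁, idealOrder_comap_of_etale u₁' J₁ y] at hy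
      exact absurd hx₁ (not_le.mpr hy)
    · have hxO : x₁ ∈ Φ₁ ⁻¹ᵁ O := fun hxZ => hr (hb₁ x₁ hxZ)
      have hord : idealOrder J₁ x₁ = idealOrder J (Φ₁ x₁) := by
        have h1 := idealOrder_comap_of_etale (Φ₁ ⁻¹ᵁ O).ι J₁ ⟨x₁, hxO⟩
        have h2 := idealOrder_comap_of_etale ((Φ₁ ⁻¹ᵁ O).ι ≫ Φ₁) J ⟨x₁, hxO⟩
        rw [hJO₁] at h1
        rw [h1] at h2
        exact h2
      rw [hord] at hx₁
      rcases hJZ _ hx₁ with h | h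
      · exact absurd h hxO
      · exact h
  have hZ₂W : Φ₁ ⁻¹' Z₂ ⊆ Set.range (Φ₁ ⁻¹ᵁ W).ι := by
    intro x₁ hx₁
    rw [Scheme.Opens.range_ι]
    change Φ₁ x₁ ∈ (W : Set X)
    rw [hW, Scheme.Hom.coe_opensRange]
    exact hZ₂u hx₁
  have hred : OrderReducible J₁ m :=
    OrderReducible.of_isOpenImmersion hX₁ (Φ₁ ⁻¹ᵁ W).ι J₁ (Φ₁ ⁻¹' Z₂) (hZ₂.preimage Φ₁.continuous) hJZ₂ hZ₂W h₂'
  exact OrderReducible.of_isPermissibleBlowupSeq hseq₁ hred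

/-- **TWO-PIECE PATCHING, open-subscheme form**: `Zᵢ ⊆ Vᵢ` (`Vᵢ : X.Opens`), `Z₁ ∩ V₂ = ∅ = Z₂ ∩ V₁`, every point of
order `≥ m` in `Z₁ ∪ Z₂`, and `(Vᵢ, J|_{Vᵢ}, m)` order-reducible for `i = 1, 2` ⇒ `(X, J, m)` order-reducible.
[cite: Piltant2013, Prop. 5.1 (proof, Step 2)] -/
theorem OrderReducible.of_opens_pair {X : Scheme.{u}} [IsLocallyNoetherian X] (hX : Scheme.IsRegular X)
    (J : X.IdealSheafData) {m : ℕ} (V₁ V₂ : X.Opens) (Z₁ Z₂ : Set X) (hZ₁ : IsClosed Z₁) (hZ₂ : IsClosed Z₂)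
    (hZ₁V : Z₁ ⊆ (V₁ : Set X)) (hZ₂V : Z₂ ⊆ (V₂ : Set X)) (h12 : Disjoint Z₁ (V₂ : Set X))
    (h21 : Disjoint Z₂ (V₁ : Set X)) (hJZ : ∀ x : X, (m : ℕ∞) ≤ idealOrder J x → x ∈ Z₁ ∪ Z₂)
    (h₁ : OrderReducible (J.comap V₁.ι) m) (h₂ : OrderReducible (J.comap V₂.ι) m) : OrderReducible J m :=
  OrderReducible.of_isOpenImmersion_pair hX J V₁.ι V₂.ι Z₁ Z₂ hZ₁ hZ₂ (by rwa [Scheme.Opens.range_ι])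
    (by rwa [Scheme.Opens.range_ι]) (by rwa [Scheme.Opens.range_ι]) (by rwa [Scheme.Opens.range_ι]) hJZ h₁ h₂

end CampaignW46

end Summit.ResolutionOfSingularities.ResolutionOfSingularities.Theorems

end
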